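import Literature.Geometry.Riemannian.ChristoffelLinearTransport
import Literature.Geometry.Riemannian.MetricComponentsInverse
import Mathlib.Analysis.InnerProductSpace.Adjoint
import HarnessLib

/-!
# The Christoffel pairing on the round sphere of the surgery: `⟪p, Γ̃_p(X)(X)⟫ ≤ λ √q G̃(X, X)`

Topic `Geometry/Riemannian`. The round picture of the interior surgery of Weinstein's disk is
obtained from the ellipsoid picture by a linear isomorphism `A` (the ellipsoid `{‖A x‖ = 1}`
becomes the unit sphere), with chart metric `g̃` of components `G̃(A v)(A u, A w) = G(v)(u, w)`.
This file converts

* the near-axis Christoffel bound of the tube metric, `|⟪w, Γ_x(X')(X')⟫| ≤ C ‖X'‖² ‖w‖`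
  (`TubeChristoffelNearAxis.lean`, with `w = α ε₀ + β p^⊥`), and
* the near-axis comparability `(1 - η)‖Y‖² ≤ G_x(Y, Y) ≤ (1 + η)‖Y‖²`
  (`TubeMetricNearAxis.lean`)

at the points `x = A⁻¹ p` of the ellipsoid into the pointwise hypothesis `hΓ` of
`SphereSecondFundamentalForm.neg_mul_val_le_val_covariantDerivAlong_sphereNormal` on the unit
sphere: **`⟪p, Γ̃_p(X)(X)⟫ ≤ λ √q(p) G̃_p(X, X)`** with `λ = C √(1 + η)/(1 - η)`,
`q(p) = G̃_p(N, N)`, `N = (G̃ p)⁻¹⟪p, ·⟫` (`sphere_inner_christoffel_le`). Ingredients: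
`Γ̃_p(X)(X) = A Γ_x(A⁻¹X)(A⁻¹X)` (`christoffel_linear_pullback`), `⟪p, A ·⟫ = ⟪A† p, ·⟫`, and the
Cauchy–Schwarz inequality for the positive form `G̃_p` (`sq_le_mul_of_posSemidef`), which bounds
`‖A† p‖ ≤ √(1 + η) √q`.

## References

* A. Weinstein, Ann. of Math. (2) 87 (1968), 29–41, proof of the main theorem, step (2).
  [cite: Weinstein1968]
* B. O'Neill, *Semi-Riemannian Geometry* (1983), Ch. 3, Prop. 13. [cite: ONeill1983, Ch. 3, Prop. 3.13]

Tags: [Sphere] [ChristoffelSymbols] [Weinstein1968]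
-/

noncomputable section

open Bundle Set Function Filter TopologicalSpace
open scoped Manifold ContDiff Topology RealInnerProductSpace

namespace Literature.Geometry.Riemannian

open Literature.Geometry.Lorentzian
open Literature.Geometry.Lorentzian.OpensChart

/-- **Cauchy–Schwarz for a symmetric positive semidefinite bilinear form**:
`(B a b)² ≤ B a a · B b b`. [folklore] -/
theorem sq_le_mul_of_posSemidef {V : Type*} [NormedAddCommGroup V] [NormedSpace ℝ V]
    (B : V →L[ℝ] V →L[ℝ] ℝ) (hsymm : ∀ a b, B a b = B b a) (hpos : ∀ a, 0 ≤ B a a) (a b : V) :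
    (B a b) ^ 2 ≤ B a a * B b b := by
  -- `0 ≤ B(t a - b, t a - b) = t² B a a - 2 t B a b + B b b` for all `t`
  have hquad : ∀ t : ℝ, 0 ≤ B a a * t ^ 2 - 2 * B a b * t + B b b := by
    intro t
    have h := hpos (t • a - b)
    have e : B (t • a - b) (t • a - b) = B a a * t ^ 2 - 2 * B a b * t + B b b := by
      rw [B.map_sub₂, B.map_smul₂, map_sub, map_smul, map_sub, map_smul, hsymm b a]
      simp only [smul_eq_mul]
      ring
    rw [e] at h
    exact h
  by_cases hA : B a a = 0
  · -- then `B a b = 0`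
    have hlin : ∀ t : ℝ, 0 ≤ -(2 * B a b) * t + B b b := fun t ↦ by
      have := hquad t; rw [hA] at this; linarith
    have hab : B a b = 0 := by
      by_contra hne
      -- take `t = (B b b + 1) / (2 B a b)`
      have h := hlin ((B b b + 1) / (2 * B a b))
      have h2 : -(2 * B a b) * ((B b b + 1) / (2 * B a b)) = -(B b b + 1) := by
        field_simp
      rw [h2] at h
      linarith
    rw [hab, hA]; simp
  · have hApos : 0 < B a a := lt_of_le_of_ne (hpos a) (Ne.symm hA)
    -- take `t = B a b / B a a`
    have h := hquad (B a b / B a a)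
    have e : B a a * (B a b / B a a) ^ 2 - 2 * B a b * (B a b / B a a) + B b b =
        (B a a * B b b - (B a b) ^ 2) / B a a := by
      field_simp
      ring
    rw [e, le_div_iff₀ hApos, zero_mul] at h
    linarith

variable {V : Type*} [NormedAddCommGroup V] [InnerProductSpace ℝ V] [FiniteDimensional ℝ V]
  {U U' : Opens V}
  (gU : PseudoRiemannianMetric 𝓘(ℝ, V) ∞ V (TangentSpace 𝓘(ℝ, V) : U → Type _))
  (gU' : PseudoRiemannianMetric 𝓘(ℝ, V) ∞ V (TangentSpace 𝓘(ℝ, V) : U' → Type _))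
  (GU GU' : V → V →L[ℝ] V →L[ℝ] ℝ)

/-- **A lower bound for `q = G̃(N, N)`**: for a Riemannian chart metric with components `G̃` at
`p`, `N = (G̃ p)⁻¹⟪p, ·⟫`, and any `Y`: `⟪p, Y⟫² ≤ q · G̃_p(Y, Y)` (Cauchy–Schwarz, `G̃(N, Y) = ⟪p, Y⟫`).
[folklore] -/
theorem inner_sq_le_rawNormal_mul (hG' : ∀ y : U', gU'.val y = GU' y) (hgU' : gU'.IsRiemannian)
    (p : U') (Y : V) :
    ⟪(p : V), Y⟫ ^ 2 ≤
      GU' p ((GU' p).inverse (innerSL ℝ (p : V))) ((GU' p).inverse (innerSL ℝ (p : V))) *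
        GU' p Y Y := by
  set N : V := (GU' p).inverse (innerSL ℝ (p : V)) with hN
  have hval : GU' (p : V) N Y = ⟪(p : V), Y⟫ := by
    have h := val_inverse_metricComponents_apply gU' GU' hG' p (innerSL ℝ (p : V)) Y
    rw [innerSL_apply_apply] at h
    exact (DFunLike.congr_fun (DFunLike.congr_fun (hG' p) N) Y).symm.trans h
  have hsymm : ∀ a b : V, GU' (p : V) a b = GU' (p : V) b a := fun a b ↦ by
    have h := gU'.symm p a b
    rw [hG' p] at h
    exact h
  have hpos : ∀ a : V, 0 ≤ GU' (p : V) a a := fun a ↦ by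
    by_cases ha : a = 0
    · subst ha; simp
    · have h := hgU' p a ha
      rw [hG' p] at h
      exact h.le
  have hcs := sq_le_mul_of_posSemidef (GU' (p : V)) hsymm hpos N Y
  rw [hval] at hcs
  exact hcs

/-- **`⟪p, Γ̃_p(X)(X)⟫ ≤ λ √q G̃_p(X, X)` on the unit sphere of the round picture.** Data at each
point `p` of the unit sphere of `U'`: a point `x` of `U` with `A x = p`, at which
(i) `|⟪w, Γ_x(X')(X')⟫| ≤ C‖X'‖²‖w‖` for all `w, X'`, (ii) `(1-η)‖Y‖² ≤ G_x(Y,Y) ≤ (1+η)‖Y‖²`,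
and (iii) near `x` the components of `g_U` are the pullback of those of `g_{U'}` under `A`. Then
with `λ = C √(1+η) / (1-η)`: `⟪p, Γ̃_p(X)(X)⟫ ≤ λ √(G̃_p(N,N)) G̃_p(X, X)` for all `X`.
[cite: Weinstein1968, proof of the main theorem, step (2)] -/
theorem sphere_inner_christoffel_le (A : V ≃L[ℝ] V) (hG : ∀ y : U, gU.val y = GU y)
    (hG' : ∀ y : U', gU'.val y = GU' y) (hgU' : gU'.IsRiemannian) {C η : ℝ} (hC : 0 ≤ C)
    (hη : 0 ≤ η) (hη1 : η < 1)
    (hdata : ∀ p : U', ‖(p : V)‖ = 1 → ∃ x : U, A (x : V) = (p : V) ∧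
      (∀ w X' : V, |⟪w, christoffel gU GU x X' X'⟫| ≤ C * ‖X'‖ ^ 2 * ‖w‖) ∧
      (∀ Y : V, (1 - η) * ‖Y‖ ^ 2 ≤ GU x Y Y ∧ GU x Y Y ≤ (1 + η) * ‖Y‖ ^ 2) ∧
      (∀ᶠ v in 𝓝 (x : V), ∀ u w : V, GU v u w = GU' (A v) (A u) (A w)))
    (p : U') (hp : ‖(p : V)‖ = 1) (X : V) :
    ⟪(p : V), christoffel gU' GU' p X X⟫ ≤
      C * Real.sqrt (1 + η) / (1 - η) *
        Real.sqrt (GU' p ((GU' p).inverse (innerSL ℝ (p : V))) ((GU' p).inverse (innerSL ℝ (p : V)))) *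
        GU' p X X := by
  haveI : CompleteSpace V := FiniteDimensional.complete ℝ V
  obtain ⟨x, hxp, hΓ, hcomp, hpull⟩ := hdata p hp
  have hGd : DifferentiableAt ℝ GU x := (contDiffAt_metricComponents gU GU hG x).differentiableAt (by simp)
  have hG'd : DifferentiableAt ℝ GU' p :=
    (contDiffAt_metricComponents gU' GU' hG' p).differentiableAt (by simp)
  set X' : V := A.symm X with hX'
  have hAX' : A X' = X := A.apply_symm_apply X
  -- transport of the Christoffel map
  have hΓt : christoffel gU' GU' p X X = A (christoffel gU GU x X' X') := by
    rw [christoffel_linear_pullback (gU := gU) (gU' := gU') A x p hxp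
      (fun a b ↦ DFunLike.congr_fun (DFunLike.congr_fun (hG x) a) b)
      (fun a b ↦ DFunLike.congr_fun (DFunLike.congr_fun (hG' p) a) b) hpull hGd hG'd X' X', hAX']
  -- `⟪p, A Γ⟫ = ⟪A† p, Γ⟫`
  set w : V := (A : V →L[ℝ] V).adjoint (p : V) with hw
  have hinner : ⟪(p : V), christoffel gU' GU' p X X⟫ = ⟪w, christoffel gU GU x X' X'⟫ := by
    rw [hΓt, hw, ContinuousLinearMap.adjoint_inner_left]
    rfl
  -- the metric at `p` in terms of `x`
  have hGX : GU' (p : V) X X = GU (x : V) X' X' := by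
    rw [hpull.self_of_nhds X' X', hxp, hAX']
  -- `‖w‖² ≤ (1 + η) q`
  set q : ℝ := GU' p ((GU' p).inverse (innerSL ℝ (p : V))) ((GU' p).inverse (innerSL ℝ (p : V)))
    with hq
  have hq0 : 0 ≤ q := by
    have h1 : 0 ≤ ⟪(p : V), (p : V)⟫ ^ 2 := sq_nonneg _
    have h2 := inner_sq_le_rawNormal_mul gU' GU' hG' hgU' p (p : V)
    have h3 : ⟪(p : V), (p : V)⟫ = 1 := by rw [real_inner_self_eq_norm_sq, hp, one_pow]
    rw [h3, one_pow] at h2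
    -- `1 ≤ q * G(p,p)` with `G(p,p) > 0`
    have h4 : 0 < GU' (p : V) (p : V) (p : V) := by
      have hp0 : (p : V) ≠ 0 := by
        intro h0; rw [h0, norm_zero] at hp; exact zero_ne_one hp
      have h := hgU' p (p : V) hp0
      rw [hG' p] at h
      exact h
    by_contra hneg
    rw [not_le] at hneg
    nlinarith
  have hw2 : ‖w‖ ^ 2 ≤ (1 + η) * q := by
    have h1 := inner_sq_le_rawNormal_mul gU' GU' hG' hgU' p (A w)
    have h2 : ⟪(p : V), A w⟫ = ‖w‖ ^ 2 := by
      have e := ContinuousLinearMap.adjoint_inner_left (A : V →L[ℝ] V) w (p : V)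
      rw [← hw, real_inner_self_eq_norm_sq] at e
      exact e.symm
    have h3 : GU' (p : V) (A w) (A w) = GU (x : V) w w := by
      rw [hpull.self_of_nhds w w, hxp]
    rw [h2, h3] at h1
    have h4 : GU (x : V) w w ≤ (1 + η) * ‖w‖ ^ 2 := (hcomp w).2
    -- `‖w‖⁴ ≤ q (1+η) ‖w‖²`
    by_cases hw0 : ‖w‖ = 0
    · rw [hw0]
      have : 0 ≤ (1 + η) * q := mul_nonneg (by linarith) hq0
      simpa using this
    · have hwpos : 0 < ‖w‖ ^ 2 := by positivity
      have h5 : ‖w‖ ^ 2 * ‖w‖ ^ 2 ≤ q * ((1 + η) * ‖w‖ ^ 2) := by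
        calc ‖w‖ ^ 2 * ‖w‖ ^ 2 = (‖w‖ ^ 2) ^ 2 := by ring
          _ ≤ q * GU (x : V) w w := h1
          _ ≤ q * ((1 + η) * ‖w‖ ^ 2) := mul_le_mul_of_nonneg_left h4 hq0
      nlinarith
  have hwle : ‖w‖ ≤ Real.sqrt (1 + η) * Real.sqrt q := by
    rw [← Real.sqrt_mul (by linarith), ← Real.sqrt_sq (norm_nonneg w)]
    exact Real.sqrt_le_sqrt hw2
  -- `‖X'‖² ≤ G(X', X')/(1 - η)`
  have h1η : 0 < 1 - η := by linarith
  have hX2 : ‖X'‖ ^ 2 ≤ GU (x : V) X' X' / (1 - η) := by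
    rw [le_div_iff₀ h1η]
    have := (hcomp X').1
    linarith
  -- assemble
  rw [hinner]
  have hGpos : 0 ≤ GU (x : V) X' X' := by
    have := (hcomp X').1
    nlinarith [sq_nonneg ‖X'‖]
  calc ⟪w, christoffel gU GU x X' X'⟫
      ≤ |⟪w, christoffel gU GU x X' X'⟫| := le_abs_self _
    _ ≤ C * ‖X'‖ ^ 2 * ‖w‖ := hΓ w X'
    _ ≤ C * (GU (x : V) X' X' / (1 - η)) * (Real.sqrt (1 + η) * Real.sqrt q) := by
        apply mul_le_mul (mul_le_mul_of_nonneg_left hX2 hC) hwle (norm_nonneg _)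
        exact mul_nonneg hC (div_nonneg hGpos h1η.le)
    _ = C * Real.sqrt (1 + η) / (1 - η) * Real.sqrt q * GU' (p : V) X X := by
        rw [hGX]; field_simp

end Literature.Geometry.Riemannian

end
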